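/-
Copyright (c) 2026 the pub-hodgecm-mathlib formalisation cell (harness21).  Prover seat hodgecm-mathlib-F0P3a-p07 (g11): road «S3-tree» (LEAD F0P3a-plan (g11), architect
A-p16 (g29) ruling A-87 (2) «(c″-F1) RAMIFIED GOOD-REDUCTION FRAME»), brick «SPAN-0-ram», the frame producer; 2026-09-01.
-/
import Literature.NumberTheory.Automorphic.UnitaryLatticeTreeSelfDualTransitiveOfTrace   -- ★ p846267 (this seat): brings the T1 cone (`pairing`, `IsIntMatrix`, `formCongr` frame change, `isIntMatrix_nonsing_inv_of_v_det_eq_one`, `eq_one_of_mul_self_eq_one`)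
import Mathlib.LinearAlgebra.CrossProduct
import HarnessLib

/-!
# The lattice graph of a hermitian space — A UNIMODULAR HERMITIAN FORM WITH A RESIDUALLY ISOTROPIC VECTOR IS `(−det H)·(σA)ᵀJ₀A`, `A ∈ GL₃(𝒪)` — the good-reduction frame
# without a datum (unramified and tamely ramified places alike) (Jacobowitz 1962 §3, §7–§8; O'Meara §82F)

Topic `NumberTheory/Automorphic`; namespace `Literature.NumberTheory.Automorphic.UnitaryLatticeTree`.  THEOREMS ONLY (no definition, no instance, no notation, no named fact,
no `sorry`); kernel lane.  Cell `pub/hodgecm-mathlib` (D-0151), crux H413 = `stmt-HodgeConjecture-24833`; road «S3-tree», brick **«SPAN-0-ram» (c″-F1)** (architect A-87 (2)): the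
PRODUCER of the frame block (F) of ★ `UnitaryVertexStabilizerSpanSelfDualRamifiedCM` — at a place where every `σ`-fixed unit need not be a norm (RAMIFIED `w`), a unimodular
`σ`-hermitian `H ∈ GL₃(𝒪)` is congruent over `𝒪` to the split form `J₀` only UP TO THE UNIT SCALAR `−det H` (two classes, `disc ∈ 𝒪_v^×∕N`); ★ `HermitianUnimodular.exists_formCongr_eq`
(all fixed units norms) does not apply there.
HYPOTHESES (datum-free): `σ` an involution preserving `v`; a trace-one integral element (`t + σt = 1`; ramified: `t = 1∕2`); the (norm) property of `σ`-FIXED `1`-units (as in both data);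
`H` `σ`-hermitian, integral, `|det H| = 1`; and a PRIMITIVE integral vector `x` with `|h(x,x)| < 1` (residual isotropy — automatic over a finite residue field by Chevalley–Warning when
`σ̄ = id`, i.e. at a ramified place; supplied by the caller).
THE MATHEMATICS.  (§1) the isotropy equation `c + α + σα + qασα = 0` (`σc = c ∈ 𝔪`, `σq = q ∈ 𝒪`) is solvable with `|α| ≤ |c|` from (trace)+(norm) alone (★ B-p14's datum proof,
datum-free).  (§2) `h(x, ·)` of a primitive integral `x` takes the value `1` on `𝒪³` (`y = H⁻¹((σxᵢ)⁻¹eᵢ)`), so `f₀ = x + αy` is an exactly ISOTROPIC primitive integral vector, and a second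
partner gives an isotropic `f₂ ∈ 𝒪³` with `h(f₀,f₂) = 1`.  (§3) THE COMPLEMENT `u = a ×₃ b`, `a = σ(f₀)ᵀH`, `b = σ(f₂)ᵀH` (rows): `h(f₀,u) = h(f₂,u) = 0`, and by the cofactor identity
`Hp ×₃ Hq = ᵗadj(H)(p ×₃ q)` plus Lagrange, **`h(u,u) = det H·(h(f₀,f₀)h(f₂,f₂) − h(f₂,f₀)h(f₀,f₂)) = −det H`**.  (§4) The frame `C = (f₀ | u | f₂)` is integral with `ᵗσ(C)HC =
[[0,0,1],[0,−det H,0],[1,0,0]] = (−det H)·ᵗσ(E)J₀E`, `E = diag(1,1,(−det H)⁻¹)`, so `|det C| = 1`, `C ∈ GL₃(𝒪)`, and **`H = (−det H) • ᵗσ(A)J₀A` with `A = EC⁻¹ ∈ GL₃(𝒪)`**.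
HONEST LABEL: HC_CM is proved only modulo the 2 remaining named inputs (hLiu418 24832, h413 24833) until rung 0 closes; nothing printed is asserted here (elementary lattice
algebra over a valuation ring with involution); S3 (`stub_N6nsS3id`) stays a print row until the road's END lands.

* §1 **`exists_isotropic_coeff_of_trace_of_norm`**.  §2 `σ_pairing_eq`, `v_pairing_le_one`, `exists_pairing_eq_one_of_primitive`, `exists_isotropic_primitive`.
* §3 `mulVec_cross_mulVec` (cofactor identity), `pairing_eq_vecMul_dotProduct`, `map_vecMul_eq_mulVec`, `pairing_cross_cross`.  §4 **`exists_glInt_eq_smul_formCongr_antidiagonal_of_isotropic`**.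

## References
* [Jacobowitz1962] R. Jacobowitz, *Hermitian forms over local fields*, Amer. J. Math. 84 (1962), §3 Thm. 3.1 (Witt), §7–§8 (unimodular lattices, unramified ∕ ramified).
* [Omeara1963] O. T. O'Meara, *Introduction to Quadratic Forms* (1963), §82F.
* [BruhatTits1972] F. Bruhat, J. Tits, *Groupes réductifs sur un corps local I*, Publ. Math. IHÉS 41 (1972), §10.
-/

set_option autoImplicit false

noncomputable section

open scoped Valued WithZero Matrix MatrixGroups
open Matrix

namespace Literature.NumberTheory.Automorphic.UnitaryLatticeTree

open Literature.NumberTheory.Automorphic Literature.NumberTheory.Automorphic.HermitianLattice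
open Literature.NumberTheory.Automorphic.CartanUnique

variable {K : Type*} [Field K] [Valued K ℤᵐ⁰] {σ : K →+* K} {ϖ : K} {N : ℕ}

/-! ## §1 The isotropy equation from (trace) + (norm), datum-free -/

/-- **The isotropy equation, datum-free** (★ `UnramifiedLocalConjDatum.exists_isotropic_coeff`'s proof uses only (trace) and (norm)): for `σc = c ∈ 𝔪`, `σq = q ∈ 𝒪`
there is `α` with `|α| ≤ |c|` and `c + α + σα + q·α·σα = 0`. [cite: Jacobowitz1962, §7] [cite: Omeara1963, §82F] -/
theorem exists_isotropic_coeff_of_trace_of_norm (htrace : ∃ t : K, Valued.v t ≤ 1 ∧ t + σ t = 1)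
    (hnorm : ∀ u : K, σ u = u → Valued.v (u - 1) < 1 → ∃ z : K, z * σ z = u ∧ Valued.v (z - 1) ≤ Valued.v (u - 1))
    {c q : K} (hσc : σ c = c) (hσq : σ q = q) (hvq : Valued.v q ≤ 1) (hvc : Valued.v c < 1) :
    ∃ α : K, Valued.v α ≤ Valued.v c ∧ c + α + σ α + q * (α * σ α) = 0 := by
  by_cases hq : q = 0
  · obtain ⟨t, ht1, htt⟩ := htrace
    refine ⟨-(c * t), ?_, ?_⟩
    · rw [Valuation.map_neg, map_mul]
      calc Valued.v c * Valued.v t ≤ Valued.v c * 1 := mul_le_mul' le_rfl ht1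
        _ = Valued.v c := mul_one _
    · rw [hq, zero_mul, add_zero, map_neg, map_mul, hσc]
      linear_combination (-c) * htt
  · have hσu : σ (1 - q * c) = 1 - q * c := by rw [map_sub, map_one, map_mul, hσq, hσc]
    have hvqc : Valued.v (q * c) < 1 := by
      rw [map_mul]
      calc Valued.v q * Valued.v c ≤ 1 * Valued.v c := mul_le_mul' hvq le_rfl
        _ < 1 := by rw [one_mul]; exact hvc
    have hu1 : Valued.v ((1 - q * c) - 1) < 1 := by
      rw [show (1 - q * c) - 1 = -(q * c) by ring, Valuation.map_neg]; exact hvqc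
    obtain ⟨z, hz, hz1⟩ := hnorm _ hσu hu1
    rw [show (1 - q * c) - 1 = -(q * c) by ring, Valuation.map_neg, map_mul] at hz1
    have hvq0 : Valued.v q ≠ 0 := (Valuation.ne_zero_iff _).2 hq
    refine ⟨(z - 1) / q, ?_, ?_⟩
    · rw [map_div₀, div_le_iff₀ (zero_lt_iff.2 hvq0), mul_comm]; exact hz1
    · have hσα : σ ((z - 1) / q) = (σ z - 1) / q := by rw [map_div₀, map_sub, map_one, hσq]
      rw [hσα]
      field_simp
      linear_combination hz

/-! ## §2 Pairings: symmetry, integrality, partners of primitive vectors, an exactly isotropic primitive vector -/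

omit [Valued K ℤᵐ⁰] in
/-- Hermitian symmetry of the pairing: `σ h(x,y) = h(y,x)` for `σ` an involution and `ᵗσ(H) = H`. [cite: Jacobowitz1962, §3] -/
theorem σ_pairing_eq (hσ : ∀ a, σ (σ a) = a) {H : Matrix (Fin N) (Fin N) K} (hH : (H.map σ)ᵀ = H) (x y : Fin N → K) :
    σ (pairing σ H x y) = pairing σ H y x := by
  have hHe : ∀ i j, σ (H i j) = H j i := fun i j => by
    have h := congrFun (congrFun hH j) i
    rw [Matrix.transpose_apply, Matrix.map_apply] at h
    exact h
  rw [pairing_apply, pairing_apply, map_sum, Finset.sum_comm]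
  refine Finset.sum_congr rfl fun j _ => ?_
  rw [map_sum]
  refine Finset.sum_congr rfl fun i _ => ?_
  rw [map_mul, map_mul, hσ, hHe]; ring

/-- The pairing of integral vectors for an integral `H` is integral. [cite: Omeara1963, §82F] -/
theorem v_pairing_le_one (hvσ : ∀ a, Valued.v (σ a) = Valued.v a) {H : Matrix (Fin N) (Fin N) K} (hH : IsIntMatrix H)
    {x y : Fin N → K} (hx : x ∈ stdLattice K N) (hy : y ∈ stdLattice K N) : Valued.v (pairing σ H x y) ≤ 1 := by
  rw [pairing_apply]
  refine Valuation.map_sum_le _ fun i _ => Valuation.map_sum_le _ fun j _ => ?_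
  rw [map_mul, map_mul, hvσ]
  exact mul_le_one' (mul_le_one' (hx i) (hH i j)) (hy j)

/-- **A primitive integral vector has a partner**: for `H` integral with `|det H| = 1` and `x ∈ 𝒪^N` with a unit coordinate `xᵢ`, the integral vector `y = H⁻¹((σxᵢ)⁻¹eᵢ)`
has `h(x, y) = 1`. [cite: Omeara1963, §82F (82:17)] -/
theorem exists_pairing_eq_one_of_primitive (hvσ : ∀ a, Valued.v (σ a) = Valued.v a) {H : Matrix (Fin N) (Fin N) K} (hH : IsIntMatrix H)
    (hdet : Valued.v H.det = 1) {x : Fin N → K} {i : Fin N} (hxi : Valued.v (x i) = 1) :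
    ∃ y : Fin N → K, y ∈ stdLattice K N ∧ pairing σ H x y = 1 := by
  have hHu : IsUnit H.det := isUnit_iff_ne_zero.2 fun h => by rw [h, map_zero] at hdet; exact zero_ne_one hdet
  have hσx0 : σ (x i) ≠ 0 := fun h => by rw [← hvσ, h, map_zero] at hxi; exact zero_ne_one hxi
  refine ⟨H⁻¹.mulVec (Pi.single i (σ (x i))⁻¹), fun k => ?_, ?_⟩
  · change Valued.v (H⁻¹.mulVec (Pi.single i (σ (x i))⁻¹) k) ≤ 1
    rw [Matrix.mulVec, dotProduct]
    refine Valuation.map_sum_le _ fun j _ => ?_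
    rw [map_mul]
    refine mul_le_one' (isIntMatrix_nonsing_inv_of_v_det_eq_one hH hdet k j) ?_
    by_cases hj : j = i
    · subst hj; rw [Pi.single_eq_same, map_inv₀, hvσ, hxi, inv_one]
    · rw [Pi.single_eq_of_ne hj, map_zero]; exact zero_le
  · rw [pairing_mulVec_right, Matrix.mul_nonsing_inv _ hHu, pairing_apply, Finset.sum_eq_single i]
    · rw [Finset.sum_eq_single i]
      · rw [Matrix.one_apply_eq, mul_one, Pi.single_eq_same, mul_inv_cancel₀ hσx0]
      · intro j _ hj; rw [Pi.single_eq_of_ne hj, mul_zero]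
      · intro h; exact absurd (Finset.mem_univ _) h
    · intro k _ hk
      refine Finset.sum_eq_zero fun j _ => ?_
      by_cases hj : j = i
      · subst hj; rw [Matrix.one_apply_ne hk, mul_zero, zero_mul]
      · rw [Pi.single_eq_of_ne hj, mul_zero]
    · intro h; exact absurd (Finset.mem_univ _) h

/-- **AN EXACTLY ISOTROPIC PRIMITIVE INTEGRAL VECTOR FROM A RESIDUALLY ISOTROPIC ONE**: `f₀ = x + αy` with the partner `y` of `x` and `α` from §1 (`c = h(x,x) ∈ 𝔪`, `q = h(y,y)`),
`|α| < 1`, so `f₀ ≡ x (mod 𝔪)` keeps the unit coordinate. [cite: Jacobowitz1962, §7–§8] [cite: Omeara1963, §82F] -/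
theorem exists_isotropic_primitive (hσ : ∀ a, σ (σ a) = a) (hvσ : ∀ a, Valued.v (σ a) = Valued.v a)
    (htrace : ∃ t : K, Valued.v t ≤ 1 ∧ t + σ t = 1)
    (hnorm : ∀ u : K, σ u = u → Valued.v (u - 1) < 1 → ∃ z : K, z * σ z = u ∧ Valued.v (z - 1) ≤ Valued.v (u - 1))
    {H : Matrix (Fin N) (Fin N) K} (hH : (H.map σ)ᵀ = H) (hHint : IsIntMatrix H) (hdet : Valued.v H.det = 1)
    {x : Fin N → K} (hx : x ∈ stdLattice K N) {i : Fin N} (hxi : Valued.v (x i) = 1) (hxx : Valued.v (pairing σ H x x) < 1) :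
    ∃ f₀ : Fin N → K, f₀ ∈ stdLattice K N ∧ Valued.v (f₀ i) = 1 ∧ pairing σ H f₀ f₀ = 0 := by
  obtain ⟨y, hy, hxy⟩ := exists_pairing_eq_one_of_primitive hvσ hHint hdet hxi
  have hyx : pairing σ H y x = 1 := by rw [← σ_pairing_eq hσ hH, hxy, map_one]
  obtain ⟨α, hαv, hαeq⟩ := exists_isotropic_coeff_of_trace_of_norm htrace hnorm (σ_pairing_eq hσ hH x x) (σ_pairing_eq hσ hH y y)
    (v_pairing_le_one hvσ hHint hy hy) hxx
  have hα1 : Valued.v α < 1 := lt_of_le_of_lt hαv hxx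
  refine ⟨x + α • y, fun k => ?_, ?_, ?_⟩
  · change Valued.v ((x + α • y) k) ≤ 1
    rw [Pi.add_apply, Pi.smul_apply, smul_eq_mul]
    refine Valuation.map_add_le _ (hx k) ?_
    rw [map_mul]; exact mul_le_one' hα1.le (hy k)
  · rw [Pi.add_apply, Pi.smul_apply, smul_eq_mul]
    have hlt : Valued.v (α * y i) < Valued.v (x i) := by
      rw [hxi, map_mul]; exact lt_of_le_of_lt (mul_le_of_le_one_right' (hy i)) hα1
    rw [Valuation.map_add_eq_of_lt_left _ hlt, hxi]
  · have h : pairing σ H (x + α • y) (x + α • y) = pairing σ H x x + α + σ α + pairing σ H y y * (α * σ α) := by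
      simp only [map_add, LinearMap.add_apply, form_smul_left, form_smul_right, hxy, hyx]; ring
    rw [h, hαeq]

/-! ## §3 The complement of a hyperbolic pair: the cofactor identity and the Lagrange identity -/

omit [Valued K ℤᵐ⁰] in
/-- **The cofactor identity**: `Mp ×₃ Mq = ᵗadj(M)·(p ×₃ q)` for every `3 × 3` matrix `M`. [cite: Jacobowitz1962, §3] -/
theorem mulVec_cross_mulVec (M : Matrix (Fin 3) (Fin 3) K) (p q : Fin 3 → K) :
    crossProduct (M.mulVec p) (M.mulVec q) = Matrix.vecMul (crossProduct p q) M.adjugate := by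
  rw [Matrix.adjugate_fin_three]
  ext i
  fin_cases i <;> simp [cross_apply, Matrix.mulVec, Matrix.vecMul, dotProduct, Fin.sum_univ_three] <;> ring

omit [Valued K ℤᵐ⁰] in
/-- The pairing as a dot product with the row `a = σ(x)ᵀH`: `h(x, y) = a ⬝ y`. [cite: Jacobowitz1962, §3] -/
theorem pairing_eq_vecMul_dotProduct (H : Matrix (Fin N) (Fin N) K) (x y : Fin N → K) :
    pairing σ H x y = dotProduct (Matrix.vecMul (fun i => σ (x i)) H) y := by
  rw [pairing_eq_dotProduct, Matrix.dotProduct_mulVec]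

omit [Valued K ℤᵐ⁰] in
/-- `σ` of the row `σ(x)ᵀH` is the column `Hx` (`σ` an involution, `ᵗσ(H) = H`). [cite: Jacobowitz1962, §3] -/
theorem map_vecMul_eq_mulVec (hσ : ∀ a, σ (σ a) = a) {H : Matrix (Fin N) (Fin N) K} (hH : (H.map σ)ᵀ = H) (x : Fin N → K) :
    (fun j => σ (Matrix.vecMul (fun i => σ (x i)) H j)) = H.mulVec x := by
  have hHe : ∀ i j, σ (H i j) = H j i := fun i j => by
    have h := congrFun (congrFun hH j) i
    rw [Matrix.transpose_apply, Matrix.map_apply] at h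
    exact h
  funext j
  rw [Matrix.vecMul, dotProduct, map_sum, Matrix.mulVec, dotProduct]
  refine Finset.sum_congr rfl fun i _ => ?_
  rw [map_mul, hσ, hHe, mul_comm]

omit [Valued K ℤᵐ⁰] in
/-- `σ` commutes with the cross product (componentwise polynomial). [cite: Jacobowitz1962, §3] -/
theorem map_crossProduct (a b : Fin 3 → K) : (fun j => σ (crossProduct a b j)) = crossProduct (fun j => σ (a j)) (fun j => σ (b j)) := by
  funext j
  fin_cases j <;> simp [cross_apply]

omit [Valued K ℤᵐ⁰] in
/-- **THE LENGTH OF THE COMPLEMENT** (`σ` an involution, `ᵗσ(H) = H`): for `u = a ×₃ b` with `a = σ(f₀)ᵀH`, `b = σ(f₂)ᵀH`,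
`h(u, u) = det H · (h(f₀,f₀)·h(f₂,f₂) − h(f₂,f₀)·h(f₀,f₂))` — the cofactor identity (`σu = Hf₀ ×₃ Hf₂ = ᵗadj(H)(f₀ ×₃ f₂)`), `adj(H)·H = det H`, and Lagrange's identity.
[cite: Jacobowitz1962, §3 Thm. 3.1] -/
theorem pairing_cross_cross (hσ : ∀ a, σ (σ a) = a) {H : Matrix (Fin 3) (Fin 3) K} (hH : (H.map σ)ᵀ = H) (f₀ f₂ : Fin 3 → K) :
    pairing σ H (crossProduct (Matrix.vecMul (fun i => σ (f₀ i)) H) (Matrix.vecMul (fun i => σ (f₂ i)) H))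
        (crossProduct (Matrix.vecMul (fun i => σ (f₀ i)) H) (Matrix.vecMul (fun i => σ (f₂ i)) H)) =
      H.det * (pairing σ H f₀ f₀ * pairing σ H f₂ f₂ - pairing σ H f₂ f₀ * pairing σ H f₀ f₂) := by
  set a := Matrix.vecMul (fun i => σ (f₀ i)) H with ha
  set b := Matrix.vecMul (fun i => σ (f₂ i)) H with hb
  rw [pairing_eq_dotProduct, map_crossProduct, ha, hb, map_vecMul_eq_mulVec hσ hH, map_vecMul_eq_mulVec hσ hH, mulVec_cross_mulVec,
    ← Matrix.dotProduct_mulVec, Matrix.mulVec_mulVec, Matrix.adjugate_mul, Matrix.smul_mulVec, Matrix.one_mulVec, dotProduct_smul, smul_eq_mul,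
    cross_dot_cross, pairing_eq_vecMul_dotProduct, pairing_eq_vecMul_dotProduct, pairing_eq_vecMul_dotProduct, pairing_eq_vecMul_dotProduct, ← ha, ← hb,
    dotProduct_comm f₀ a, dotProduct_comm f₂ b, dotProduct_comm f₀ b, dotProduct_comm f₂ a]

omit [Valued K ℤᵐ⁰] in
/-- Gram entries of a column matrix for a general form: `h(C eᵢ, C eⱼ) = (ᵗσ(C) H C)ᵢⱼ`. [cite: Jacobowitz1962, §3] -/
theorem pairing_mulVec_single_eq_gram (H C : Matrix (Fin N) (Fin N) K) (i j : Fin N) :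
    pairing σ H (C.mulVec (Pi.single i 1)) (C.mulVec (Pi.single j 1)) = ((C.map σ)ᵀ * H * C) i j := by
  rw [pairing_mulVec_left, pairing_mulVec_right, pairing_single_single]

/-! ## §4 The frame -/

set_option maxHeartbeats 800000 in
/-- **A UNIMODULAR HERMITIAN FORM WITH A RESIDUALLY ISOTROPIC PRIMITIVE VECTOR IS `(−det H)·ᵗσ(A)J₀A` WITH `A ∈ GL₃(𝒪)`** (datum-free: `σ` an involution preserving `v`,
(trace), (norm) for `σ`-fixed `1`-units; `H` `σ`-hermitian, integral, `|det H| = 1`; `x ∈ 𝒪³` with a unit coordinate and `|h(x,x)| < 1`).  The unit scalar `−det H` is explicit;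
it can be absorbed into `A` iff it is a norm (always at an unramified place — ★ `HermitianUnimodular.exists_formCongr_eq`; NOT in general at a ramified one).  This is the
producer of the frame block (F) of ★ `span_isSelfDual_of_neg` ∕ ★ `span_isSelfDual_std_of_neg` (with `c = −det H_w`, `|c| = 1`). [cite: Jacobowitz1962, §3 Thm. 3.1, §8] [cite: BruhatTits1972, §10] -/
theorem exists_glInt_eq_smul_formCongr_antidiagonal_of_isotropic (hσ : ∀ a, σ (σ a) = a) (hvσ : ∀ a, Valued.v (σ a) = Valued.v a)
    (htrace : ∃ t : K, Valued.v t ≤ 1 ∧ t + σ t = 1)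
    (hnorm : ∀ u : K, σ u = u → Valued.v (u - 1) < 1 → ∃ z : K, z * σ z = u ∧ Valued.v (z - 1) ≤ Valued.v (u - 1))
    {H : Matrix (Fin 3) (Fin 3) K} (hH : (H.map σ)ᵀ = H) (hHint : IsIntMatrix H) (hdet : Valued.v H.det = 1)
    {x : Fin 3 → K} (hx : x ∈ stdLattice K 3) {i : Fin 3} (hxi : Valued.v (x i) = 1) (hxx : Valued.v (pairing σ H x x) < 1) :
    ∃ A : GL (Fin 3) K, IsIntMatrix (A : Matrix (Fin 3) (Fin 3) K) ∧ IsIntMatrix ((A⁻¹ : GL (Fin 3) K) : Matrix (Fin 3) (Fin 3) K) ∧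
      H = (-H.det) • formCongr σ A ((StdForm.antidiagonal 3).over K) := by
  obtain ⟨t, ht1, htt⟩ := id htrace
  have hHd0 : H.det ≠ 0 := fun h => by rw [h, map_zero] at hdet; exact zero_ne_one hdet
  have hσdet : σ H.det = H.det := by
    have h := congrArg Matrix.det hH
    rw [Matrix.det_transpose, ← RingHom.mapMatrix_apply, ← RingHom.map_det] at h
    exact h
  have herm : ∀ y z : Fin 3 → K, pairing σ H z y = σ (pairing σ H y z) := fun y z => (σ_pairing_eq hσ hH y z).symm
  -- §2: an exactly isotropic primitive `f₀ ∈ 𝒪³` and an isotropic partner `f₂ ∈ 𝒪³`, `h(f₀,f₂) = 1`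
  obtain ⟨f₀, hf₀, hf₀i, hf₀f₀⟩ := exists_isotropic_primitive hσ hvσ htrace hnorm hH hHint hdet hx hxi hxx
  obtain ⟨y, hy, hf₀y⟩ := exists_pairing_eq_one_of_primitive hvσ hHint hdet (x := f₀) hf₀i
  have hyf₀ : pairing σ H y f₀ = 1 := by rw [herm, hf₀y, map_one]
  have hση : σ (pairing σ H y y) = pairing σ H y y := σ_pairing_eq hσ hH y y
  set ν : K := -(t * pairing σ H y y) with hν
  have hvν : Valued.v ν ≤ 1 := by rw [hν, Valuation.map_neg, map_mul]; exact mul_le_one' ht1 (v_pairing_le_one hvσ hHint hy hy)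
  have hσν : σ ν = -(σ t * pairing σ H y y) := by rw [hν, map_neg, map_mul, hση]
  set f₂ : Fin 3 → K := y + ν • f₀ with hf₂def
  have hf₂ : f₂ ∈ stdLattice K 3 := fun k => by
    change Valued.v ((y + ν • f₀) k) ≤ 1
    rw [Pi.add_apply, Pi.smul_apply, smul_eq_mul]
    refine Valuation.map_add_le _ (hy k) ?_
    rw [map_mul]; exact mul_le_one' hvν (hf₀ k)
  have hf₀f₂ : pairing σ H f₀ f₂ = 1 := by rw [hf₂def, map_add, form_smul_right, hf₀y, hf₀f₀, mul_zero, add_zero]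
  have hf₂f₀ : pairing σ H f₂ f₀ = 1 := by rw [herm, hf₀f₂, map_one]
  have hf₂f₂ : pairing σ H f₂ f₂ = 0 := by
    have h : pairing σ H f₂ f₂ = pairing σ H y y + ν + σ ν := by
      simp only [hf₂def, map_add, LinearMap.add_apply, form_smul_left, form_smul_right, hyf₀, hf₀y, hf₀f₀]; ring
    rw [h, hσν, hν]
    linear_combination (-(pairing σ H y y)) * htt
  -- §3: the complement `u = a ×₃ b`
  set a : Fin 3 → K := Matrix.vecMul (fun k => σ (f₀ k)) H with ha
  set b : Fin 3 → K := Matrix.vecMul (fun k => σ (f₂ k)) H with hb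
  set u : Fin 3 → K := crossProduct a b with hu
  have haint : ∀ k, Valued.v (a k) ≤ 1 := fun k => by
    rw [ha, Matrix.vecMul, dotProduct]
    refine Valuation.map_sum_le _ fun j _ => ?_
    rw [map_mul, hvσ]; exact mul_le_one' (hf₀ j) (hHint j k)
  have hbint : ∀ k, Valued.v (b k) ≤ 1 := fun k => by
    rw [hb, Matrix.vecMul, dotProduct]
    refine Valuation.map_sum_le _ fun j _ => ?_
    rw [map_mul, hvσ]; exact mul_le_one' (hf₂ j) (hHint j k)
  have huint : u ∈ stdLattice K 3 := fun k => by
    change Valued.v (crossProduct a b k) ≤ 1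
    have hmul : ∀ k l, Valued.v (a k * b l) ≤ 1 := fun k l => by rw [map_mul]; exact mul_le_one' (haint k) (hbint l)
    rw [cross_apply]
    fin_cases k <;> exact Valuation.map_sub_le _ (hmul _ _) (hmul _ _)
  have hf₀u : pairing σ H f₀ u = 0 := by rw [pairing_eq_vecMul_dotProduct, ← ha, hu]; exact dot_self_cross a b
  have hf₂u : pairing σ H f₂ u = 0 := by rw [pairing_eq_vecMul_dotProduct, ← hb, hu]; exact dot_cross_self a b
  have huf₀ : pairing σ H u f₀ = 0 := by rw [herm, hf₀u, map_zero]
  have huf₂ : pairing σ H u f₂ = 0 := by rw [herm, hf₂u, map_zero]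
  have huu : pairing σ H u u = -H.det := by
    rw [hu, ha, hb, pairing_cross_cross hσ hH, hf₀f₀, hf₂f₂, hf₂f₀, hf₀f₂]; ring
  -- §4: the frame `C = (f₀ | u | f₂)`
  set C : Matrix (Fin 3) (Fin 3) K := (Matrix.of ![f₀, u, f₂])ᵀ with hC
  have hC0 : C.mulVec (Pi.single 0 1) = f₀ := transpose_of_mulVec_single _ 0
  have hC1 : C.mulVec (Pi.single 1 1) = u := transpose_of_mulVec_single _ 1
  have hC2 : C.mulVec (Pi.single 2 1) = f₂ := transpose_of_mulVec_single _ 2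
  have hCint : IsIntMatrix C := by
    intro k l
    fin_cases l
    · have h := congrFun hC0 k; rw [Matrix.mulVec_single_one] at h; simp only [Matrix.col_apply] at h; rw [Fin.zero_eta, h]; exact hf₀ k
    · have h := congrFun hC1 k; rw [Matrix.mulVec_single_one] at h; simp only [Matrix.col_apply] at h; rw [Fin.mk_one, h]; exact huint k
    · have h := congrFun hC2 k; rw [Matrix.mulVec_single_one] at h; simp only [Matrix.col_apply] at h; simp only [Fin.reduceFinMk]; rw [h]; exact hf₂ k
  have hGram : (C.map σ)ᵀ * H * C = !![0, 0, 1; 0, -H.det, 0; 1, 0, 0] := by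
    ext k l
    rw [← pairing_mulVec_single_eq_gram]
    fin_cases k <;> fin_cases l <;>
      simp only [Fin.zero_eta, Fin.mk_one, Fin.reduceFinMk, hC0, hC1, hC2, hf₀f₀, hf₀u, hf₀f₂, huf₀, huu, huf₂, hf₂f₀, hf₂u, hf₂f₂] <;> rfl
  -- `|det C| = 1`
  have hdetC : Valued.v C.det = 1 := by
    have h := congrArg Matrix.det hGram
    have hR : (!![0, 0, 1; 0, -H.det, 0; 1, 0, 0] : Matrix (Fin 3) (Fin 3) K).det = H.det := by
      rw [Matrix.det_fin_three]; simp
    rw [Matrix.det_mul, Matrix.det_mul, Matrix.det_transpose, show (C.map σ).det = σ C.det by rw [RingHom.map_det, RingHom.mapMatrix_apply], hR] at h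
    -- `σ(det C) · det H · det C = det H`
    have h' := congrArg Valued.v h
    rw [map_mul, map_mul, hvσ, hdet, mul_one] at h'
    exact eq_one_of_mul_self_eq_one h'
  have hCd0 : C.det ≠ 0 := fun h => by rw [h, map_zero] at hdetC; exact zero_ne_one hdetC
  set Cg : GL (Fin 3) K := Matrix.GeneralLinearGroup.mkOfDetNeZero C hCd0 with hCg
  have hCgval : (Cg : Matrix (Fin 3) (Fin 3) K) = C := rfl
  have hCinv : IsIntMatrix ((Cg⁻¹ : GL (Fin 3) K) : Matrix (Fin 3) (Fin 3) K) := by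
    rw [Matrix.coe_units_inv, hCgval]; exact isIntMatrix_nonsing_inv_of_v_det_eq_one hCint hdetC
  -- the scalar frame `E = diag(1, 1, (−det H)⁻¹)`
  have ha0 : (-H.det) ≠ 0 := neg_ne_zero.2 hHd0
  have hEd : (Matrix.diagonal ![(1 : K), 1, (-H.det)⁻¹]).det ≠ 0 := by
    rw [Matrix.det_diagonal, Fin.prod_univ_three]; simp [hHd0]
  set E : GL (Fin 3) K := Matrix.GeneralLinearGroup.mkOfDetNeZero _ hEd with hE
  have hEval : (E : Matrix (Fin 3) (Fin 3) K) = Matrix.diagonal ![(1 : K), 1, (-H.det)⁻¹] := rfl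
  have hva : Valued.v (-H.det) = 1 := by rw [Valuation.map_neg, hdet]
  have hEint : IsIntMatrix (E : Matrix (Fin 3) (Fin 3) K) := by
    rw [hEval]; intro k l
    fin_cases k <;> fin_cases l <;> simp [Matrix.diagonal, hdet]
  have hEinv_val : ((E⁻¹ : GL (Fin 3) K) : Matrix (Fin 3) (Fin 3) K) = Matrix.diagonal ![(1 : K), 1, -H.det] := by
    rw [Matrix.coe_units_inv, hEval]
    apply Matrix.inv_eq_left_inv
    rw [Matrix.diagonal_mul_diagonal, ← Matrix.diagonal_one]
    congr 1; funext k; fin_cases k <;> simp [hHd0]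
  have hEinv : IsIntMatrix ((E⁻¹ : GL (Fin 3) K) : Matrix (Fin 3) (Fin 3) K) := by
    rw [hEinv_val]; intro k l
    fin_cases k <;> fin_cases l <;> simp [Matrix.diagonal, hva]
  have hJ : ∀ k l : Fin 3, (StdForm.antidiagonal 3).over K k l = if l = Fin.rev k then (1 : K) else 0 := by
    intro k l
    simp only [StdForm.over, Matrix.map_apply, StdForm.antidiagonal_J_apply]
    split_ifs <;> simp
  have hEJ : (-H.det) • formCongr σ E ((StdForm.antidiagonal 3).over K) = !![0, 0, 1; 0, -H.det, 0; 1, 0, 0] := by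
    rw [formCongr, hEval]
    ext k l
    fin_cases k <;> fin_cases l <;> simp [Matrix.mul_apply, Fin.sum_univ_three, hJ, Fin.rev, Matrix.diagonal, map_inv₀, map_neg, hσdet, hHd0]
  -- assemble: `H = formCongr C⁻¹ (ᵗσ(C)HC) = (−det H) • formCongr (E C⁻¹) J₀`
  have hHC : formCongr σ Cg H = (-H.det) • formCongr σ E ((StdForm.antidiagonal 3).over K) := by
    rw [formCongr, hCgval, hGram, hEJ]
  refine ⟨E * Cg⁻¹, ?_, ?_, ?_⟩
  · rw [Units.val_mul]; exact isIntMatrix_mul hEint hCinv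
  · rw [_root_.mul_inv_rev, inv_inv, Units.val_mul, hCgval]; exact isIntMatrix_mul hCint hEinv
  · calc H = formCongr σ Cg⁻¹ (formCongr σ Cg H) := (formCongr_inv_formCongr σ Cg H).symm
      _ = formCongr σ Cg⁻¹ ((-H.det) • formCongr σ E ((StdForm.antidiagonal 3).over K)) := by rw [hHC]
      _ = (-H.det) • formCongr σ Cg⁻¹ (formCongr σ E ((StdForm.antidiagonal 3).over K)) := by
          simp only [formCongr, Matrix.mul_smul, Matrix.smul_mul]
      _ = (-H.det) • formCongr σ (E * Cg⁻¹) ((StdForm.antidiagonal 3).over K) := by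
          simp only [formCongr, Units.val_mul, Matrix.map_mul, Matrix.transpose_mul, Matrix.mul_assoc]

end Literature.NumberTheory.Automorphic.UnitaryLatticeTree

end
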